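import Literature.NumberTheory.Automorphic.BrandtModuleModPMultiplicityOne
import Literature.NumberTheory.Automorphic.ShimuraCurveTakahashiCoordinateInputs
import Literature.NumberTheory.Automorphic.BrandtEichlerLevelUOperators
import Literature.NumberTheory.EllipticCurves.ComplexMultiplicationLFunctionIsogenyHoldsProofs
import HarnessLib

/-!
# Route `RamifiedHeegnerPair`, crux U₁ `LeafRankOneUpperAtThree` (stmt-BirchSwinnertonDyer-26022), line `partnerdescent` —
# **the print stub MULT-ONE is the named fact `ribet1990_characterGroup_multiplicityOne` BY NAME**

HONEST FRAMING. Theorems only; helper file (`--supports stmt-BirchSwinnertonDyer-26022`); a short instantiation of the cite-only Literature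
named fact `Literature.NumberTheory.Automorphic.ribet1990_characterGroup_multiplicityOne` (‹BrandtModuleModPMultiplicityOne›, typed by this seat:
mod-`ℓ` multiplicity one for the character group `X_d(J₀(N))`, `d ∥ N`, in Brandt coordinates — Darmon–Diamond–Taylor 1995 Thm. 4.26 (a) for
`dim J₀(N)[𝔪] = 2` and Ribet's toric Frobenius argument as printed by Edixhoven 1997 (3.2.3) ∕ p. 232 ∕ (3.3.12) ∕ (3.3.15), Helm 2007 Def. 6.4 ∕
Lemma 6.5; a `def … : Prop`, nothing asserted, net debt +1) at the binders of the stub MULT-ONE `Partnerdescent.LeafMultiplicityOneAtThree` (one text,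
two cruxes: U₁ 26022 `partnerdescent`, U₀ 26024 `splitkolyvagin0`). No number theory is proved here; no `sorry`; nothing booked; the crux stays OPEN and
merely becomes conditional on one more NAMED print fact instead of a lead-typed stub; BSD is proved for no curve. Lead prover bsd-line-rhp-p2 g67, 2026-08-31.

WHAT. `leafMultiplicityOne_of_print : ribet1990_characterGroup_multiplicityOne → ‹MULT-ONE text VERBATIM›`. The fact is stated for `W` of conductor `N⁺·d`
(`d` prime, `d ∤ N⁺`), an odd prime `ℓ ∤ N⁺d` and the `a(W)`-eigen-lattice; the stub is its instance `ℓ = 3`, `N⁺ = pM` read through a class-minimal Shimura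
datum `P` of a curve `W′ ∼ W`: `d ∤ pM` from admissibility (`D = pd` square-free and prime to `M`, `d ≠ p`), `N = pMd`, `a_n(W′) = a_n(W)` by the tree
theorem `LFunction_eq_of_isIsogenous_holds`, `3 ≠ 2`, `9 = 3²`.
-/

set_option linter.dupNamespace false
set_option autoImplicit false

noncomputable section

namespace Summit.BirchSwinnertonDyer.BirchSwinnertonDyer.Theorems.LeafPartnerOrders

open scoped Pointwise Matrix
open Matrix Literature.NumberTheory.Automorphic Literature.NumberTheory.Automorphic.Brandt Literature.NumberTheory.EllipticCurves

open scoped Classical in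
/-- **MULT-ONE from print, BY NAME**: the named fact `ribet1990_characterGroup_multiplicityOne` instantiated at `ℓ = 3`, `N⁺ = pM` and the binders of the
v10 stub `Partnerdescent.LeafMultiplicityOneAtThree` (statement VERBATIM the stub text). [cite: DarmonDiamondTaylor1995, Thm. 4.26 (a) (§4.5, p. 134)]
[cite: Edixhoven1997, §3.3 (3.3.12)] [cite: Helm2007, Def. 6.4, Lemma 6.5] -/
theorem leafMultiplicityOne_of_print (hM1 : ribet1990_characterGroup_multiplicityOne) :
    ∀ {N D M p d : ℕ}, p.Prime → D = p * d → IsAdmissibleFactorization N D M →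
      ∀ (X : ShimuraCurveData D M) (W : WeierstrassCurve ℚ) [W.IsElliptic] [W.IsGloballyMinimal],
        W.conductorNorm ℤ = N → ¬ 3 ∣ N → W.HasIrreducibleModPGaloisRep 3 →
      ∀ [Fact d.Prime], d ≠ p → W.HasSplitMultiplicativeReductionAtPrime d →
        Nat.card (AddSubgroup.torsionBy ((W.baseChange ℚ_[d]).toAffine.Point) 3) ≠ 9 →
      ∀ (W' : WeierstrassCurve ℚ) [W'.IsElliptic] (P : ShimuraParametrizationData X W'), P.IsMinimalFor W →
      ∀ (S : Brandt.XiSetup (p * M) d) [Fintype (ClassSet S.O)] [DecidableEq (ClassSet S.O)]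
        (B : Submodule ℤ (ClassSet S.O → ℤ)), (∀ v, v ∈ B ↔ ∑ c, v c = 0) →
      ∀ (lamq : ℕ → ℤ), (∀ q : ℕ, q.Prime →
          ∀ v ∈ eigenLattice (p * M * d) (Brandt.matrix S.O) (fun n ↦ W'.LFunction n), S.heckeAt q *ᵥ v = lamq q • v) →
      ∃ x₀ ∈ B, ∀ x ∈ B, ∃ C ∈ S.fullHeckeAlgebra, x - C *ᵥ x₀ ∈
        (3 : ℤ) • B ⊔ ⨆ (q : ℕ) (_ : q.Prime),
          B.map (Matrix.mulVecLin (S.heckeAt q - lamq q • (1 : Matrix (ClassSet S.O) (ClassSet S.O) ℤ))) := by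
  intro N D M p d hp hD hadm X W _ _ hN h3 hirr _ hdp hsplit hcard W' _ P hP S _ _ B hB lamq hlam
  have hd : d.Prime := Fact.out
  -- `d ∤ pM`: `d ≠ p` and `d ∣ D` is prime to `M`
  have hndvd : ¬ d ∣ p * M := by
    intro h
    rcases (Nat.Prime.dvd_mul hd).mp h with h1 | h2
    · exact hdp ((Nat.prime_dvd_prime_iff_eq hd hp).mp h1)
    · have hdD : d ∣ D := hD ▸ Dvd.intro_left p rfl
      exact hd.one_lt.ne' (Nat.Coprime.eq_one_of_dvd (Nat.Coprime.coprime_dvd_left hdD hadm.coprime) h2)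
  -- the level `N = pMd`
  have hNeq : N = p * M * d := by
    rw [← hadm.mul_eq, hD]; ring
  have hN' : W.conductorNorm ℤ = p * M * d := hNeq ▸ hN
  have h3' : ¬ 3 ∣ p * M * d := hNeq ▸ h3
  have hcard' : Nat.card (AddSubgroup.torsionBy ((W.baseChange ℚ_[d]).toAffine.Point) 3) ≠ 3 ^ 2 := by
    norm_num; exact hcard
  -- `a_n(W′) = a_n(W)` (isogeny invariance, tree theorem)
  have hLf : (fun n ↦ W'.LFunction n) = (fun n ↦ W.LFunction n) := by
    rw [LFunction_eq_of_isIsogenous_holds W W' hP.1]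
  have hlam' : ∀ q : ℕ, q.Prime →
      ∀ v ∈ eigenLattice (p * M * d) (Brandt.matrix S.O) (fun n ↦ W.LFunction n), S.heckeAt q *ᵥ v = lamq q • v := by
    rw [← hLf]; exact hlam
  haveI : Fact (Nat.Prime 3) := ⟨Nat.prime_three⟩
  exact hM1 W (p * M) d hndvd hN' 3 (by decide) h3' hirr hsplit hcard' S B hB lamq hlam'

end Summit.BirchSwinnertonDyer.BirchSwinnertonDyer.Theorems.LeafPartnerOrders

end
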